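import Mathlib.Algebra.BigOperators.Fin
import Mathlib.Algebra.BigOperators.GroupWithZero.Finset
import Mathlib.Data.Fintype.EquivFin
import Literature.Computability.AlgebraicComplexity.MatrixMultiplicationExponent
import Literature.Computability.AlgebraicComplexity.AsymptoticSpectrum
import Literature.Computability.AlgebraicComplexity.BorderRankCW
import HarnessLib

/-!
# The laser method for the little Coppersmith–Winograd tensor: Kronecker powers restrict to
direct sums of matrix multiplication tensors (BCS 1997 §15.6/§15.8, Bläser 2013 §9.2) — proved

Topic `Literature/Computability/AlgebraicComplexity`. The tensor-algebra half of the proof of the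
Coppersmith–Winograd bound `ω ≤ log_q(4 R̃(T_cw,q)³/27)` (`CoppersmithWinograd1990.lean`):
for the little Coppersmith–Winograd tensor `T = T_cw,q = cwTensor K q` (`BorderRankCW.lean`) with
its block decomposition `{0} ∪ {1,…,q}` of each index set, support
`{(0,1,1),(1,0,1),(1,1,0)}` and components `⟨1,1,q⟩, ⟨q,1,1⟩, ⟨1,q,1⟩` (BCS p. 383 / Bläser p. 45),
the blocks of the Kronecker power `T^{⊗N}` are indexed by the zero patterns (= zero sets
`A, B, C ⊆ {1,…,N}`) of the three indices, the block `(A,B,C)` is non-zero iff `(A,B,C)` is an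
ordered partition of `{1,…,N}`, and it is then the matrix multiplication tensor
`⟨q^{|C|}, q^{|A|}, q^{|B|}⟩` (BCS p. 381: "the `D^{⊗N}`-components of `t^{⊗N}` are
`t^{⊗N}(x,y,z) ≃ ⊗_ρ t(x_ρ,y_ρ,z_ρ)`", with `supp⟨e,h,l⟩ × supp⟨e',h',l'⟩ = supp⟨ee',hh',ll'⟩`,
p. 372). Consequently (`cw_kroneckerPow_blocks`), for every family `Δ` of balanced ordered
partitions `(A,B,C)` (`|A| = |B| = |C| = m`) which is a *free diagonal* (no ordered partition
`(A_δ, B_δ', C_δ'')` mixes three members of `Δ` other than trivially), zeroing out and relabelling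
coordinates turns `T^{⊗N}` into `⟨|Δ|⟩ ⊗ ⟨q^m, q^m, q^m⟩` EXACTLY:
`⟨|Δ|⟩ ⊗ ⟨q^m,q^m,q^m⟩ = T^{⊗N} ∘ (F × G × H)` for explicit index maps `F, G, H` — which is the
restriction `⊕_{Δ} t^{⊗N}(x,y,z) ≤ t^{⊗N}` of BCS p. 381 (there via Prop. 15.30) in coordinates.
Everything is PROVED; no definition is introduced (the index maps are exhibited inside the proof).

## References

* P. Bürgisser, M. Clausen, M. A. Shokrollahi, *Algebraic Complexity Theory* (1997), §15.6
  (pp. 370–373: supports, `D`-components of tensor powers, diagonals), §15.8 (pp. 380–383: proof of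
  Thm. 15.41 and its application to `t^{(q)} = T_cw,q`). [BurgisserClausenShokrollahi1997]
* M. Bläser, *Fast Matrix Multiplication*, ToC Graduate Surveys 5 (2013), §8.1 (Def. 8.1–8.2,
  Lemma 8.3), §9.2 (pp. 45–46). [Blaser2013]
-/

noncomputable section

open scoped BigOperators
open Finset

namespace Literature.Computability.AlgebraicComplexity

universe u

variable {K : Type u} [CommSemiring K]

/-! ## Entries of `T_cw,q` on the blocks -/

section Entries

variable (K)

/-- `T_cw,q(0, x+1, y+1) = [x = y]`: the block `(0,1,1)` of `T_cw,q` is `⟨1,q,1⟩`-like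
(BCS p. 383: `t(0,1,1) ≃ ⟨1,1,q⟩`). [cite: BurgisserClausenShokrollahi1997, §15.8 (p. 383)] -/
theorem cwTensor_zero_succ_succ (q : ℕ) (x y : Fin q) :
    cwTensor K q 0 x.succ y.succ = if x = y then 1 else 0 := by
  simp only [cwTensor_apply, Fin.succ_inj, Fin.succ_ne_zero, ne_eq, not_false_eq_true, and_true,
    true_and, false_and, or_false, (Fin.succ_ne_zero x).symm]

/-- `T_cw,q(x+1, 0, y+1) = [x = y]` (block `(1,0,1)`). [cite: BurgisserClausenShokrollahi1997, §15.8 (p. 383)] -/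
theorem cwTensor_succ_zero_succ (q : ℕ) (x y : Fin q) :
    cwTensor K q x.succ 0 y.succ = if x = y then 1 else 0 := by
  simp only [cwTensor_apply, Fin.succ_inj, Fin.succ_ne_zero, ne_eq, not_false_eq_true, and_true,
    true_and, false_and, or_false, false_or, (Fin.succ_ne_zero y).symm, and_false]

/-- `T_cw,q(x+1, y+1, 0) = [x = y]` (block `(1,1,0)`). [cite: BurgisserClausenShokrollahi1997, §15.8 (p. 383)] -/
theorem cwTensor_succ_succ_zero (q : ℕ) (x y : Fin q) :
    cwTensor K q x.succ y.succ 0 = if x = y then 1 else 0 := by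
  simp only [cwTensor_apply, Fin.succ_inj, Fin.succ_ne_zero, ne_eq, not_false_eq_true, and_true,
    true_and, false_or, and_false]

/-- The support of `T_cw,q` with respect to the blocks `{0} ∪ {1,…,q}` is
`{(0,1,1),(1,0,1),(1,1,0)}`: a non-zero entry has exactly one zero coordinate (BCS p. 383).
[cite: BurgisserClausenShokrollahi1997, §15.8 (p. 383)] -/
theorem cwTensor_ne_zero_pattern (q : ℕ) {i j k : Fin (q + 1)} (h : cwTensor K q i j k ≠ 0) :
    (i = 0 ∧ j ≠ 0 ∧ k ≠ 0) ∨ (j = 0 ∧ i ≠ 0 ∧ k ≠ 0) ∨ (k = 0 ∧ i ≠ 0 ∧ j ≠ 0) := by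
  rw [cwTensor_apply] at h
  split_ifs at h with hc
  · rcases hc with ⟨h1, h2, h3⟩ | ⟨h1, h2, h3⟩ | ⟨h1, h2, h3⟩
    · exact Or.inl ⟨h1, h3, h2 ▸ h3⟩
    · exact Or.inr (Or.inl ⟨h1, h3, h2 ▸ h3⟩)
    · exact Or.inr (Or.inr ⟨h1, h3, h2 ▸ h3⟩)
  · exact absurd rfl h

end Entries

/-! ## One block of `T^{⊗N}` -/

section Block

variable (K)

/-- **The diagonal blocks of `T_cw,q^{⊗N}` are matrix multiplication tensors** (BCS p. 381:
`t^{⊗N}(x,y,z) ≃ ⊗_ρ t(x_ρ,y_ρ,z_ρ)` with `t(0,1,1) ⊗ … ≃ ⟨…⟩`, p. 372): for an ordered partition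
`(A, B, C)` of the positions with `|A| = |B| = |C| = m` (enumerations `eA, eB, eC`), the indices
`a` (zero exactly on `A`, carrying `κ` on `C` and `ν` on `B`), `b` (zero on `B`, `κ'` on `C`, `μ` on
`A`), `c` (zero on `C`, `μ'` on `A`, `ν'` on `B`) satisfy
`∏_ρ T(a_ρ, b_ρ, c_ρ) = [κ = κ'] [μ = μ'] [ν = ν']`, the entry of `⟨q^m, q^m, q^m⟩` at
`((κ,ν),(κ',μ),(μ',ν'))`. [cite: BurgisserClausenShokrollahi1997, §15.8 (p. 381)] -/
theorem cw_block_diag {N q m : ℕ} {A B C : Finset (Fin N)} (hAB : Disjoint A B)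
    (hAC : Disjoint A C) (hBC : Disjoint B C) (hcov : A ∪ B ∪ C = Finset.univ)
    (eA : ↥A ≃ Fin m) (eB : ↥B ≃ Fin m) (eC : ↥C ≃ Fin m) (κ ν κ' μ μ' ν' : Fin m → Fin q)
    (a b c : Fin N → Fin (q + 1))
    (ha0 : ∀ ρ ∈ A, a ρ = 0) (haC : ∀ ρ (h : ρ ∈ C), a ρ = (κ (eC ⟨ρ, h⟩)).succ)
    (haB : ∀ ρ (h : ρ ∈ B), a ρ = (ν (eB ⟨ρ, h⟩)).succ)
    (hb0 : ∀ ρ ∈ B, b ρ = 0) (hbC : ∀ ρ (h : ρ ∈ C), b ρ = (κ' (eC ⟨ρ, h⟩)).succ)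
    (hbA : ∀ ρ (h : ρ ∈ A), b ρ = (μ (eA ⟨ρ, h⟩)).succ)
    (hc0 : ∀ ρ ∈ C, c ρ = 0) (hcA : ∀ ρ (h : ρ ∈ A), c ρ = (μ' (eA ⟨ρ, h⟩)).succ)
    (hcB : ∀ ρ (h : ρ ∈ B), c ρ = (ν' (eB ⟨ρ, h⟩)).succ) :
    ∏ ρ, cwTensor K q (a ρ) (b ρ) (c ρ) = if κ = κ' ∧ μ = μ' ∧ ν = ν' then 1 else 0 := by
  classical
  have hAuBC : Disjoint (A ∪ B) C := Finset.disjoint_union_left.2 ⟨hAC, hBC⟩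
  rw [← hcov, Finset.prod_union hAuBC, Finset.prod_union hAB]
  -- the three partial products
  have hA : ∏ ρ ∈ A, cwTensor K q (a ρ) (b ρ) (c ρ) = ∏ r, if μ r = μ' r then (1 : K) else 0 := by
    rw [← Finset.prod_coe_sort A]
    refine Fintype.prod_equiv eA _ _ fun i => ?_
    rw [ha0 _ i.2, hbA _ i.2, hcA _ i.2, cwTensor_zero_succ_succ]
  have hB : ∏ ρ ∈ B, cwTensor K q (a ρ) (b ρ) (c ρ) = ∏ r, if ν r = ν' r then (1 : K) else 0 := by
    rw [← Finset.prod_coe_sort B]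
    refine Fintype.prod_equiv eB _ _ fun i => ?_
    rw [hb0 _ i.2, haB _ i.2, hcB _ i.2, cwTensor_succ_zero_succ]
  have hC : ∏ ρ ∈ C, cwTensor K q (a ρ) (b ρ) (c ρ) = ∏ r, if κ r = κ' r then (1 : K) else 0 := by
    rw [← Finset.prod_coe_sort C]
    refine Fintype.prod_equiv eC _ _ fun i => ?_
    rw [hc0 _ i.2, haC _ i.2, hbC _ i.2, cwTensor_succ_succ_zero]
  rw [hA, hB, hC]
  -- a product of indicators is the indicator of the conjunction
  have hone : ∀ u : Fin m → Fin q, ∏ r, (if u r = u r then (1 : K) else 0) = 1 := fun u => by simp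
  have hzero : ∀ u v : Fin m → Fin q, u ≠ v → ∏ r, (if u r = v r then (1 : K) else 0) = 0 := by
    intro u v h
    obtain ⟨r, hr⟩ := Function.ne_iff.1 h
    exact Finset.prod_eq_zero (Finset.mem_univ r) (if_neg hr)
  by_cases h : κ = κ' ∧ μ = μ' ∧ ν = ν'
  · obtain ⟨rfl, rfl, rfl⟩ := h
    rw [if_pos ⟨rfl, rfl, rfl⟩, hone, hone, hone, one_mul, one_mul]
  · rw [if_neg h]
    by_cases hκ : κ = κ'
    · by_cases hμ : μ = μ'
      · have hν : ν ≠ ν' := fun hν => h ⟨hκ, hμ, hν⟩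
        rw [hzero _ _ hν, mul_zero, zero_mul]
      · rw [hzero _ _ hμ, zero_mul, zero_mul]
    · rw [hzero _ _ hκ, mul_zero]

/-- **Off-diagonal blocks vanish unless the zero sets form a partition** (BCS p. 372/381:
`supp_{D^{⊗N}} t^{⊗N} = (supp_D t)^N`, `supp_D t = {(0,1,1),(1,0,1),(1,1,0)}`): if
`∏_ρ T(a_ρ,b_ρ,c_ρ) ≠ 0` then the zero sets of `a, b, c` are pairwise disjoint and cover all
positions. [cite: BurgisserClausenShokrollahi1997, §15.8 (p. 381)] -/
theorem cw_block_support {N q : ℕ} {A B C : Finset (Fin N)} (a b c : Fin N → Fin (q + 1))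
    (ha : ∀ ρ, a ρ = 0 ↔ ρ ∈ A) (hb : ∀ ρ, b ρ = 0 ↔ ρ ∈ B) (hc : ∀ ρ, c ρ = 0 ↔ ρ ∈ C)
    (hne : ∏ ρ, cwTensor K q (a ρ) (b ρ) (c ρ) ≠ 0) :
    Disjoint A B ∧ Disjoint A C ∧ Disjoint B C ∧ A ∪ B ∪ C = Finset.univ := by
  classical
  have hρ : ∀ ρ, cwTensor K q (a ρ) (b ρ) (c ρ) ≠ 0 := fun ρ h =>
    hne (Finset.prod_eq_zero (Finset.mem_univ ρ) h)
  have hpat := fun ρ => cwTensor_ne_zero_pattern K q (hρ ρ)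
  refine ⟨?_, ?_, ?_, ?_⟩
  · rw [Finset.disjoint_left]
    intro ρ hA hB
    rcases hpat ρ with ⟨-, h2, -⟩ | ⟨-, h1, -⟩ | ⟨-, h1, -⟩
    · exact h2 ((hb ρ).2 hB)
    · exact h1 ((ha ρ).2 hA)
    · exact h1 ((ha ρ).2 hA)
  · rw [Finset.disjoint_left]
    intro ρ hA hC
    rcases hpat ρ with ⟨-, -, h3⟩ | ⟨-, h1, -⟩ | ⟨-, h1, -⟩
    · exact h3 ((hc ρ).2 hC)
    · exact h1 ((ha ρ).2 hA)
    · exact h1 ((ha ρ).2 hA)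
  · rw [Finset.disjoint_left]
    intro ρ hB hC
    rcases hpat ρ with ⟨-, h2, -⟩ | ⟨-, -, h3⟩ | ⟨-, -, h2⟩
    · exact h2 ((hb ρ).2 hB)
    · exact h3 ((hc ρ).2 hC)
    · exact h2 ((hb ρ).2 hB)
  · refine Finset.eq_univ_of_forall fun ρ => ?_
    simp only [Finset.mem_union]
    rcases hpat ρ with ⟨h1, -, -⟩ | ⟨h2, -, -⟩ | ⟨h3, -, -⟩
    · exact Or.inl (Or.inl ((ha ρ).1 h1))
    · exact Or.inl (Or.inr ((hb ρ).1 h2))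
    · exact Or.inr ((hc ρ).1 h3)

end Block

/-! ## The Kronecker power restricts to `⟨|Δ|⟩ ⊗ ⟨q^m, q^m, q^m⟩` along a free diagonal -/

section Main

variable (K)

/-- **Laser method for `T_cw,q`, combinatorial-restriction form** (BCS 1997, proof of Thm. 15.41
applied to `t^{(q)} = T_cw,q`, pp. 381–383; Bläser 2013, §9.2 pp. 45–46): let `Δ` be a family of
ordered partitions `(A,B,C)` of the `N` positions into blocks of size `m` each, which is a *free
diagonal*: whenever `(A_δ, B_{δ'}, C_{δ''})` is again an ordered partition for `δ, δ', δ'' ∈ Δ`, then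
`δ = δ' = δ''`. Then zeroing out all coordinates of `T_cw,q^{⊗N}` outside the blocks of `Δ` and
relabelling leaves exactly `⟨|Δ|⟩ ⊗ ⟨q^m, q^m, q^m⟩` (the direct sum of `|Δ|` copies of
`⟨q^m,q^m,q^m⟩`): there are index maps `F, G, H` with
`⟨|Δ|⟩ ⊗ ⟨q^m,q^m,q^m⟩ = T_cw,q^{⊗N} ∘ (F × G × H)` — BCS p. 381:
"`⊕_{(x,y,z) ∈ Δ} t^{⊗N}(x,y,z) ≤ t^{⊗N}`", each component `≃ ⟨q^{N/3}, q^{N/3}, q^{N/3}⟩`.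
[cite: BurgisserClausenShokrollahi1997, Thm. 15.41 (proof, p. 381)] -/
theorem cw_kroneckerPow_blocks (q m N : ℕ)
    (Δ : Finset (Finset (Fin N) × Finset (Fin N) × Finset (Fin N)))
    (hcard : ∀ δ ∈ Δ, δ.1.card = m ∧ δ.2.1.card = m ∧ δ.2.2.card = m)
    (hpart : ∀ δ ∈ Δ, Disjoint δ.1 δ.2.1 ∧ Disjoint δ.1 δ.2.2 ∧ Disjoint δ.2.1 δ.2.2 ∧
      δ.1 ∪ δ.2.1 ∪ δ.2.2 = Finset.univ)
    (hfree : ∀ δ ∈ Δ, ∀ δ' ∈ Δ, ∀ δ'' ∈ Δ, Disjoint δ.1 δ'.2.1 → Disjoint δ.1 δ''.2.2 →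
      Disjoint δ'.2.1 δ''.2.2 → δ.1 ∪ δ'.2.1 ∪ δ''.2.2 = Finset.univ → δ = δ' ∧ δ' = δ'') :
    ∃ (F G H : Fin Δ.card × (Fin (q ^ m) × Fin (q ^ m)) → (Fin N → Fin (q + 1))),
      kroneckerTensor (unitTensor K Δ.card) (matMulTensor K (q ^ m) (q ^ m) (q ^ m)) =
        fun x y z => kroneckerPow (cwTensor K q) N (F x) (G y) (H z) := by
  classical
  -- enumerate `Δ` and its blocks
  let δ : Fin Δ.card → Finset (Fin N) × Finset (Fin N) × Finset (Fin N) :=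
    fun s => (Δ.equivFin.symm s).1
  have hδmem : ∀ s, δ s ∈ Δ := fun s => (Δ.equivFin.symm s).2
  have hδinj : Function.Injective δ :=
    Subtype.val_injective.comp Δ.equivFin.symm.injective
  let eA : ∀ s, ↥(δ s).1 ≃ Fin m := fun s => Finset.equivFinOfCardEq (hcard _ (hδmem s)).1
  let eB : ∀ s, ↥(δ s).2.1 ≃ Fin m := fun s => Finset.equivFinOfCardEq (hcard _ (hδmem s)).2.1
  let eC : ∀ s, ↥(δ s).2.2 ≃ Fin m := fun s => Finset.equivFinOfCardEq (hcard _ (hδmem s)).2.2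
  -- `Fin (q^m)` as functions
  let f : Fin (q ^ m) → Fin m → Fin q := fun κ => finFunctionFinEquiv.symm κ
  have hf : ∀ κ κ' : Fin (q ^ m), f κ = f κ' ↔ κ = κ' := fun κ κ' =>
    finFunctionFinEquiv.symm.injective.eq_iff
  -- the index maps
  let F : Fin Δ.card × (Fin (q ^ m) × Fin (q ^ m)) → Fin N → Fin (q + 1) := fun x ρ =>
    if h : ρ ∈ (δ x.1).2.2 then (f x.2.1 (eC x.1 ⟨ρ, h⟩)).succ
    else if h' : ρ ∈ (δ x.1).2.1 then (f x.2.2 (eB x.1 ⟨ρ, h'⟩)).succ else 0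
  let G : Fin Δ.card × (Fin (q ^ m) × Fin (q ^ m)) → Fin N → Fin (q + 1) := fun y ρ =>
    if h : ρ ∈ (δ y.1).2.2 then (f y.2.1 (eC y.1 ⟨ρ, h⟩)).succ
    else if h' : ρ ∈ (δ y.1).1 then (f y.2.2 (eA y.1 ⟨ρ, h'⟩)).succ else 0
  let H : Fin Δ.card × (Fin (q ^ m) × Fin (q ^ m)) → Fin N → Fin (q + 1) := fun z ρ =>
    if h : ρ ∈ (δ z.1).1 then (f z.2.1 (eA z.1 ⟨ρ, h⟩)).succ
    else if h' : ρ ∈ (δ z.1).2.1 then (f z.2.2 (eB z.1 ⟨ρ, h'⟩)).succ else 0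
  -- zero sets of the embedded indices
  have hF0 : ∀ x ρ, F x ρ = 0 ↔ ρ ∈ (δ x.1).1 := by
    intro x ρ
    obtain ⟨hab, hac, hbc, hcov⟩ := hpart _ (hδmem x.1)
    simp only [F]
    constructor
    · intro h
      by_cases h1 : ρ ∈ (δ x.1).2.2
      · rw [dif_pos h1] at h; exact absurd h (Fin.succ_ne_zero _)
      · by_cases h2 : ρ ∈ (δ x.1).2.1
        · rw [dif_neg h1, dif_pos h2] at h; exact absurd h (Fin.succ_ne_zero _)
        · have := Finset.eq_univ_iff_forall.1 hcov ρ
          simp only [Finset.mem_union] at this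
          tauto
    · intro h
      rw [dif_neg (Finset.disjoint_left.1 hac h), dif_neg (Finset.disjoint_left.1 hab h)]
  have hG0 : ∀ y ρ, G y ρ = 0 ↔ ρ ∈ (δ y.1).2.1 := by
    intro y ρ
    obtain ⟨hab, hac, hbc, hcov⟩ := hpart _ (hδmem y.1)
    simp only [G]
    constructor
    · intro h
      by_cases h1 : ρ ∈ (δ y.1).2.2
      · rw [dif_pos h1] at h; exact absurd h (Fin.succ_ne_zero _)
      · by_cases h2 : ρ ∈ (δ y.1).1
        · rw [dif_neg h1, dif_pos h2] at h; exact absurd h (Fin.succ_ne_zero _)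
        · have := Finset.eq_univ_iff_forall.1 hcov ρ
          simp only [Finset.mem_union] at this
          tauto
    · intro h
      rw [dif_neg (Finset.disjoint_left.1 hbc h), dif_neg (Finset.disjoint_right.1 hab h)]
  have hH0 : ∀ z ρ, H z ρ = 0 ↔ ρ ∈ (δ z.1).2.2 := by
    intro z ρ
    obtain ⟨hab, hac, hbc, hcov⟩ := hpart _ (hδmem z.1)
    simp only [H]
    constructor
    · intro h
      by_cases h1 : ρ ∈ (δ z.1).1
      · rw [dif_pos h1] at h; exact absurd h (Fin.succ_ne_zero _)
      · by_cases h2 : ρ ∈ (δ z.1).2.1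
        · rw [dif_neg h1, dif_pos h2] at h; exact absurd h (Fin.succ_ne_zero _)
        · have := Finset.eq_univ_iff_forall.1 hcov ρ
          simp only [Finset.mem_union] at this
          tauto
    · intro h
      rw [dif_neg (Finset.disjoint_right.1 hac h), dif_neg (Finset.disjoint_right.1 hbc h)]
  refine ⟨F, G, H, ?_⟩
  funext x y z
  obtain ⟨s, κ, ν⟩ := x
  obtain ⟨s', κ', μ⟩ := y
  obtain ⟨s'', μ', ν'⟩ := z
  rw [kroneckerTensor_apply, kroneckerPow_apply, unitTensor_apply]
  by_cases hs : s = s' ∧ s' = s''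
  · -- a diagonal block: the matrix multiplication tensor
    obtain ⟨rfl, rfl⟩ := hs
    rw [if_pos ⟨rfl, rfl⟩, one_mul]
    obtain ⟨hab, hac, hbc, hcov⟩ := hpart _ (hδmem s)
    have key := cw_block_diag K hab hac hbc hcov (eA s) (eB s) (eC s) (f κ) (f ν) (f κ') (f μ)
      (f μ') (f ν') (F (s, κ, ν)) (G (s, κ', μ)) (H (s, μ', ν')) (fun ρ h => (hF0 _ ρ).2 h)
      (fun ρ h => by simp only [F]; rw [dif_pos h])
      (fun ρ h => by simp only [F]; rw [dif_neg (Finset.disjoint_left.1 hbc h), dif_pos h])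
      (fun ρ h => (hG0 _ ρ).2 h)
      (fun ρ h => by simp only [G]; rw [dif_pos h])
      (fun ρ h => by simp only [G]; rw [dif_neg (Finset.disjoint_left.1 hac h), dif_pos h])
      (fun ρ h => (hH0 _ ρ).2 h)
      (fun ρ h => by simp only [H]; rw [dif_pos h])
      (fun ρ h => by simp only [H]; rw [dif_neg (Finset.disjoint_right.1 hab h), dif_pos h])
    rw [key]
    simp only [matMulTensor]
    by_cases h : κ = κ' ∧ μ = μ' ∧ ν = ν'
    · rw [if_pos h, if_pos ⟨by rw [h.1], by rw [h.2.1], by rw [h.2.2]⟩]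
    · rw [if_neg h, if_neg fun h' => h ⟨(hf _ _).1 h'.1, (hf _ _).1 h'.2.1, (hf _ _).1 h'.2.2⟩]
  · -- an off-diagonal block vanishes, by freeness of `Δ`
    rw [if_neg hs, zero_mul]
    by_contra hne
    obtain ⟨h1, h2, h3, h4⟩ := cw_block_support (K := K) (F (s, κ, ν)) (G (s', κ', μ))
      (H (s'', μ', ν')) (hF0 _) (hG0 _) (hH0 _) (Ne.symm hne)
    obtain ⟨e1, e2⟩ := hfree _ (hδmem s) _ (hδmem s') _ (hδmem s'') h1 h2 h3 h4
    exact hs ⟨hδinj e1, hδinj e2⟩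

end Main

end Literature.Computability.AlgebraicComplexity

end
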